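import Summits.AtomisticToContinuum.BoseEinsteinCondensation.Theorems.BECSwapNoCatastropheTorusHalfSwapOverlapChordOfPath
import Summits.AtomisticToContinuum.BoseEinsteinCondensation.Theorems.BECSwapNoCatastropheTorusHalfSwapOverlapSwapInvariance
import Summits.AtomisticToContinuum.BoseEinsteinCondensation.Theorems.BECSwapNoCatastropheTorusHalfSwapOverlapSymmetricInfimum
import Summits.AtomisticToContinuum.BoseEinsteinCondensation.Theorems.BECSwapNoCatastropheTorusHalfSwapOverlapProductUpper
import Summits.AtomisticToContinuum.BoseEinsteinCondensation.Theorems.BECSwapNoCatastropheTorusHalfSwapOverlapProductLower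
import HarnessLib

/-!
# Crux `TorusHalfSwapOverlap` (stmt-AtomisticToContinuum-14393), line `birth`: the fixed-`n` reduction
# "midpoint-chord overlap at `v` ⇒ the crux at `v`", and the crux from rank 3 + the singular chord

Route `BECSwapNoCatastrophe` (sub-problem `BoseEinsteinCondensation`), lead c3 (2026-08-17). This file is the
COMPOSITION NODE of the line `birth` made durable: it proves the registered stub `stub_cruxOfChord` — for every
repulsive finite-range `v`, the pure two-copy CHORD overlap claim at `v` (absolutely admissible `δ`-near-minimisers
`Φ` of the uncoupled two-copy torus form `E2(0)` and `Θ` of the half-swapped form `E2(½)` satisfy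
`|⟨Θ, Φ⟩_{cell²}|² ≥ ½ + η`, uniformly in `n` at small `ρ`) implies the crux's own claim at `v` (swap-symmetric
near-minimisers `Θ` of `E2(½)` against `Ψ ⊗ Ψ` for one-copy periodic near-minimisers `Ψ`) — from the four landed
fixed-`n` stubs: `stub_productUpper`/`stub_productLower` (`Ψ ⊗ Ψ` is an absolute `2δ`-near-minimiser of `E2(0)`:
`E2(0)(Ψ⊗Ψ) ≤ 2·periodicEnergy v Ψ ≤ 2E₀^per + 2δ ≤ inf_{Adm0} E2(0) + 2δ`, bosonic = absolute infimum) and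
`stub_symmetricInfimum stub_swapInvariance` (F-symmetric infimum of `E2(½)` = absolute infimum, so a symmetric
`δ`-near-minimiser is an absolute one). Consequences (proved here):

* `cruxAt_of_pathRigidity_of_bounded` — for BOUNDED `v` the crux's claim at `v` follows from the route's rank-3
  item `TorusSwapPathRigidity` (stmt-AtomisticToContinuum-14394) alone, through the landed glue `stub_chordOfPath`;
* `torusHalfSwapOverlap_of_pathRigidity_of_singularChord` — the crux BY NAME from `TorusSwapPathRigidity` and the
  line's remaining open stub `stub_singularChord` (the chord claim for unbounded `v` / hard cores, stated verbatim).

Everything is in tree vocabulary with the two-copy objects inlined as `let`s exactly as in the route decls (no new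
definitions), so the statements are the registered signatures verbatim. [folklore bookkeeping; the mathematics sits
in the imported stub files]
-/

noncomputable section

open MeasureTheory Filter
open scoped ENNReal NNReal BigOperators ComplexConjugate

namespace Summit.AtomisticToContinuum.BoseEinsteinCondensation.Cruxes.TorusHalfSwapOverlap.Birth

open Literature.MathematicalPhysics.QuantumManyBody.BoseGas
open Summit.AtomisticToContinuum.BoseEinsteinCondensation.Theses.BECSwapNoCatastrophe
  (TorusHalfSwapOverlap TorusSwapPathRigidity)

/-- **Midpoint-chord overlap at `v` ⇒ the crux at `v`** (registered stub `stub_cruxOfChord` of line `birth`; fixed-`n`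
bookkeeping over the landed stubs): given the chord claim at `v` with `ρ₀, η` and, eventually in `n`, slack `δ₁`, the
crux's claim at `v` holds with the same `ρ₀, η` and slack `δ₁ / 2` — a swap-symmetric `δ₁/2`-near-minimiser `Θ` of
`E2(½)` is an absolute `δ₁`-near-minimiser (`stub_symmetricInfimum stub_swapInvariance`), and for a periodic
`δ₁/2`-near-minimiser `Ψ` the product `Ψ ⊗ Ψ` is an absolute `δ₁`-near-minimiser of `E2(0)` (`stub_productUpper`,
`stub_productLower`, `2·(E₀ + δ₁/2) = 2E₀ + δ₁`). [folklore] -/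
theorem stub_cruxOfChord :
    ∀ v : ℝ → ℝ≥0∞, IsRepulsiveFiniteRange v →
      (∃ ρ₀ : ℝ, 0 < ρ₀ ∧ ∀ ρ : ℝ, 0 < ρ → ρ < ρ₀ → ∃ η : ℝ, 0 < η ∧ ∀ᶠ n : ℕ in atTop,
        let L : ℝ := sideLength ρ (n + 1)
        let C2 : Set (Config (n + 1) × Config (n + 1)) := (cellN (n + 1) L) ×ˢ (cellN (n + 1) L)
        let E2z : (Config (n + 1) × Config (n + 1) → ℂ) → ℝ≥0∞ := fun Θ => ∫⁻ Z in C2,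
          kineticDensity (fun X => Θ (X, Z.2)) Z.1 + kineticDensity (fun Y => Θ (Z.1, Y)) Z.2 +
            (periodicInteraction v L Z.1 + periodicInteraction v L Z.2) * (‖Θ Z‖₊ : ENNReal) ^ 2
        let E2h : (Config (n + 1) × Config (n + 1) → ℂ) → ℝ≥0∞ := fun Θ => ∫⁻ Z in C2,
          (kineticDensity (fun X => Θ (X, Z.2)) Z.1 + kineticDensity (fun Y => Θ (Z.1, Y)) Z.2 +
            (periodicInteraction v L (Fin.tail Z.1) + periodicInteraction v L (Fin.tail Z.2) +
              ∑ j : Fin n, (2 : ENNReal)⁻¹ * (periodizedPotential v L (Z.1 0 - Z.1 j.succ) +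
                periodizedPotential v L (Z.2 0 - Z.2 j.succ) + periodizedPotential v L (Z.2 0 - Z.1 j.succ) +
                periodizedPotential v L (Z.1 0 - Z.2 j.succ))) * (‖Θ Z‖₊ : ENNReal) ^ 2)
        let Adm : (Config (n + 1) × Config (n + 1) → ℂ) → Prop := fun Θ => ContDiff ℝ 1 Θ ∧
          (∀ (Z : Config (n + 1) × Config (n + 1)) (i : Fin (n + 1)) (k : Fin 3),
            Θ (Z.1 + Pi.single i (EuclideanSpace.single k L), Z.2) = Θ Z ∧
              Θ (Z.1, Z.2 + Pi.single i (EuclideanSpace.single k L)) = Θ Z) ∧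
          ∫⁻ Z in C2, (‖Θ Z‖₊ : ENNReal) ^ 2 = 1
        ∃ δ : ℝ≥0∞, 0 < δ ∧ ∀ Φ Θ : Config (n + 1) × Config (n + 1) → ℂ,
          Adm Φ → E2z Φ ≤ (⨅ (Θ' : Config (n + 1) × Config (n + 1) → ℂ) (_ : Adm Θ'), E2z Θ') + δ →
          Adm Θ → E2h Θ ≤ (⨅ (Θ' : Config (n + 1) × Config (n + 1) → ℂ) (_ : Adm Θ'), E2h Θ') + δ →
          ENNReal.ofReal (1 / 2 + η) ≤ (‖∫ Z in C2, (starRingEnd ℂ) (Θ Z) * Φ Z‖₊ : ENNReal) ^ 2) →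
      ∃ ρ₀ : ℝ, 0 < ρ₀ ∧ ∀ ρ : ℝ, 0 < ρ → ρ < ρ₀ → ∃ η : ℝ, 0 < η ∧ ∀ᶠ n : ℕ in atTop,
          let L : ℝ := sideLength ρ (n + 1)
          let C2 : Set (Config (n + 1) × Config (n + 1)) := (cellN (n + 1) L) ×ˢ (cellN (n + 1) L)
          let E2h : (Config (n + 1) × Config (n + 1) → ℂ) → ℝ≥0∞ := fun Θ => ∫⁻ Z in C2,
            (kineticDensity (fun X => Θ (X, Z.2)) Z.1 + kineticDensity (fun Y => Θ (Z.1, Y)) Z.2 +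
              (periodicInteraction v L (Fin.tail Z.1) + periodicInteraction v L (Fin.tail Z.2) +
                ∑ j : Fin n, (2 : ENNReal)⁻¹ * (periodizedPotential v L (Z.1 0 - Z.1 j.succ) +
                  periodizedPotential v L (Z.2 0 - Z.2 j.succ) + periodizedPotential v L (Z.2 0 - Z.1 j.succ) +
                  periodizedPotential v L (Z.1 0 - Z.2 j.succ))) * (‖Θ Z‖₊ : ENNReal) ^ 2)
          let AdmS : (Config (n + 1) × Config (n + 1) → ℂ) → Prop := fun Θ => ContDiff ℝ 1 Θ ∧
            (∀ (Z : Config (n + 1) × Config (n + 1)) (i : Fin (n + 1)) (k : Fin 3),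
              Θ (Z.1 + Pi.single i (EuclideanSpace.single k L), Z.2) = Θ Z ∧
                Θ (Z.1, Z.2 + Pi.single i (EuclideanSpace.single k L)) = Θ Z) ∧
            (∀ X Y : Config (n + 1), Θ (Matrix.vecCons (Y 0) (Fin.tail X), Matrix.vecCons (X 0) (Fin.tail Y)) = Θ (X, Y)) ∧
            ∫⁻ Z in C2, (‖Θ Z‖₊ : ENNReal) ^ 2 = 1
          ∃ δ : ℝ≥0∞, 0 < δ ∧ ∀ Ψ : PeriodicTrialState (n + 1) L,
            periodicEnergy v Ψ ≤ periodicGroundStateEnergy v (n + 1) L + δ →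
            ∀ Θ : Config (n + 1) × Config (n + 1) → ℂ, AdmS Θ →
              E2h Θ ≤ (⨅ (Θ' : Config (n + 1) × Config (n + 1) → ℂ) (_ : AdmS Θ'), E2h Θ') + δ →
              ENNReal.ofReal (1 / 2 + η) ≤
                (‖∫ Z in C2, (starRingEnd ℂ) (Θ Z) * (Ψ.ψ Z.1 * Ψ.ψ Z.2)‖₊ : ENNReal) ^ 2 := by
  intro v hv H1
  obtain ⟨ρ₁, hρ₁, H1⟩ := H1
  refine ⟨ρ₁, hρ₁, fun ρ hρ hρlt => ?_⟩
  obtain ⟨η, hη, hev1⟩ := H1 ρ hρ hρlt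
  refine ⟨η, hη, ?_⟩
  filter_upwards [hev1] with n hn1
  obtain ⟨δ, hδ, hmain⟩ := hn1
  refine ⟨δ / 2, ENNReal.half_pos hδ.ne', fun Ψ hΨ Θ hΘ hΘmin => ?_⟩
  -- `Ψ ⊗ Ψ` is an absolute `δ`-near-minimiser of `E2(0)`
  obtain ⟨hΦadm, hΦle⟩ := stub_productUpper v hv n (sideLength ρ (n + 1)) Ψ
  have h2δ : (2 : ℝ≥0∞) * (δ / 2) = δ := ENNReal.mul_div_cancel two_ne_zero ENNReal.ofNat_ne_top
  have hstep : 2 * (periodicGroundStateEnergy v (n + 1) (sideLength ρ (n + 1)) + δ / 2) =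
      2 * periodicGroundStateEnergy v (n + 1) (sideLength ρ (n + 1)) + δ := by
    rw [mul_add, h2δ]
  have hlow := le_iInf₂ fun Θ' hΘ' => stub_productLower v hv n (sideLength ρ (n + 1)) Θ' hΘ'
  have hΦmin := hΦle.trans (((mul_le_mul' le_rfl hΨ).trans_eq hstep).trans (add_le_add hlow le_rfl))
  -- the crux's `Θ` is an absolute `δ`-near-minimiser of `E2(½)`
  have hinf := stub_symmetricInfimum stub_swapInvariance v hv n (sideLength ρ (n + 1))
  have hΘmin' := hΘmin.trans ((add_le_add le_rfl ENNReal.half_le_self).trans_eq (congrArg (· + δ) hinf))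
  exact hmain _ Θ hΦadm hΦmin ⟨hΘ.1, hΘ.2.1, hΘ.2.2.2⟩ hΘmin'

/-- **For bounded `v` the crux at `v` follows from rank 3 alone**: `TorusSwapPathRigidity`
(stmt-AtomisticToContinuum-14394, hypothesis by name) and boundedness of `v` give the crux's claim at `v`, through the
landed glue `stub_chordOfPath` and `stub_cruxOfChord`. [folklore] -/
theorem cruxAt_of_pathRigidity_of_bounded (h0 : TorusSwapPathRigidity) (v : ℝ → ℝ≥0∞)
    (hv : IsRepulsiveFiniteRange v) (hb : ∃ M : NNReal, ∀ r, v r ≤ M) :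
    ∃ ρ₀ : ℝ, 0 < ρ₀ ∧ ∀ ρ : ℝ, 0 < ρ → ρ < ρ₀ → ∃ η : ℝ, 0 < η ∧ ∀ᶠ n : ℕ in atTop,
        let L : ℝ := sideLength ρ (n + 1)
        let C2 : Set (Config (n + 1) × Config (n + 1)) := (cellN (n + 1) L) ×ˢ (cellN (n + 1) L)
        let E2h : (Config (n + 1) × Config (n + 1) → ℂ) → ℝ≥0∞ := fun Θ => ∫⁻ Z in C2,
          (kineticDensity (fun X => Θ (X, Z.2)) Z.1 + kineticDensity (fun Y => Θ (Z.1, Y)) Z.2 +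
            (periodicInteraction v L (Fin.tail Z.1) + periodicInteraction v L (Fin.tail Z.2) +
              ∑ j : Fin n, (2 : ENNReal)⁻¹ * (periodizedPotential v L (Z.1 0 - Z.1 j.succ) +
                periodizedPotential v L (Z.2 0 - Z.2 j.succ) + periodizedPotential v L (Z.2 0 - Z.1 j.succ) +
                periodizedPotential v L (Z.1 0 - Z.2 j.succ))) * (‖Θ Z‖₊ : ENNReal) ^ 2)
        let AdmS : (Config (n + 1) × Config (n + 1) → ℂ) → Prop := fun Θ => ContDiff ℝ 1 Θ ∧
          (∀ (Z : Config (n + 1) × Config (n + 1)) (i : Fin (n + 1)) (k : Fin 3),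
            Θ (Z.1 + Pi.single i (EuclideanSpace.single k L), Z.2) = Θ Z ∧
              Θ (Z.1, Z.2 + Pi.single i (EuclideanSpace.single k L)) = Θ Z) ∧
          (∀ X Y : Config (n + 1), Θ (Matrix.vecCons (Y 0) (Fin.tail X), Matrix.vecCons (X 0) (Fin.tail Y)) = Θ (X, Y)) ∧
          ∫⁻ Z in C2, (‖Θ Z‖₊ : ENNReal) ^ 2 = 1
        ∃ δ : ℝ≥0∞, 0 < δ ∧ ∀ Ψ : PeriodicTrialState (n + 1) L,
          periodicEnergy v Ψ ≤ periodicGroundStateEnergy v (n + 1) L + δ →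
          ∀ Θ : Config (n + 1) × Config (n + 1) → ℂ, AdmS Θ →
            E2h Θ ≤ (⨅ (Θ' : Config (n + 1) × Config (n + 1) → ℂ) (_ : AdmS Θ'), E2h Θ') + δ →
            ENNReal.ofReal (1 / 2 + η) ≤
              (‖∫ Z in C2, (starRingEnd ℂ) (Θ Z) * (Ψ.ψ Z.1 * Ψ.ψ Z.2)‖₊ : ENNReal) ^ 2 :=
  stub_cruxOfChord v hv (stub_chordOfPath h0 v hv hb)

/-- **The crux BY NAME from rank 3 and the singular chord**: `TorusSwapPathRigidity` (stmt-AtomisticToContinuum-14394)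
and the line's open stub `stub_singularChord` (the midpoint-chord overlap claim for UNBOUNDED finite-range `v`, hard
cores included — stated here verbatim as a hypothesis) imply `TorusHalfSwapOverlap`; case split on boundedness of
`v`. This is the skeleton's composition `Birth.TorusHalfSwapOverlap_of` in the tree. [folklore] -/
theorem torusHalfSwapOverlap_of_pathRigidity_of_singularChord (h0 : TorusSwapPathRigidity)
    (h1b :
      ∀ v : ℝ → ℝ≥0∞, IsRepulsiveFiniteRange v → (¬ ∃ M : NNReal, ∀ r, v r ≤ M) →
        ∃ ρ₀ : ℝ, 0 < ρ₀ ∧ ∀ ρ : ℝ, 0 < ρ → ρ < ρ₀ → ∃ η : ℝ, 0 < η ∧ ∀ᶠ n : ℕ in atTop,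
          let L : ℝ := sideLength ρ (n + 1)
          let C2 : Set (Config (n + 1) × Config (n + 1)) := (cellN (n + 1) L) ×ˢ (cellN (n + 1) L)
          let E2z : (Config (n + 1) × Config (n + 1) → ℂ) → ℝ≥0∞ := fun Θ => ∫⁻ Z in C2,
            kineticDensity (fun X => Θ (X, Z.2)) Z.1 + kineticDensity (fun Y => Θ (Z.1, Y)) Z.2 +
              (periodicInteraction v L Z.1 + periodicInteraction v L Z.2) * (‖Θ Z‖₊ : ENNReal) ^ 2
          let E2h : (Config (n + 1) × Config (n + 1) → ℂ) → ℝ≥0∞ := fun Θ => ∫⁻ Z in C2,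
            (kineticDensity (fun X => Θ (X, Z.2)) Z.1 + kineticDensity (fun Y => Θ (Z.1, Y)) Z.2 +
              (periodicInteraction v L (Fin.tail Z.1) + periodicInteraction v L (Fin.tail Z.2) +
                ∑ j : Fin n, (2 : ENNReal)⁻¹ * (periodizedPotential v L (Z.1 0 - Z.1 j.succ) +
                  periodizedPotential v L (Z.2 0 - Z.2 j.succ) + periodizedPotential v L (Z.2 0 - Z.1 j.succ) +
                  periodizedPotential v L (Z.1 0 - Z.2 j.succ))) * (‖Θ Z‖₊ : ENNReal) ^ 2)
          let Adm : (Config (n + 1) × Config (n + 1) → ℂ) → Prop := fun Θ => ContDiff ℝ 1 Θ ∧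
            (∀ (Z : Config (n + 1) × Config (n + 1)) (i : Fin (n + 1)) (k : Fin 3),
              Θ (Z.1 + Pi.single i (EuclideanSpace.single k L), Z.2) = Θ Z ∧
                Θ (Z.1, Z.2 + Pi.single i (EuclideanSpace.single k L)) = Θ Z) ∧
            ∫⁻ Z in C2, (‖Θ Z‖₊ : ENNReal) ^ 2 = 1
          ∃ δ : ℝ≥0∞, 0 < δ ∧ ∀ Φ Θ : Config (n + 1) × Config (n + 1) → ℂ,
            Adm Φ → E2z Φ ≤ (⨅ (Θ' : Config (n + 1) × Config (n + 1) → ℂ) (_ : Adm Θ'), E2z Θ') + δ →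
            Adm Θ → E2h Θ ≤ (⨅ (Θ' : Config (n + 1) × Config (n + 1) → ℂ) (_ : Adm Θ'), E2h Θ') + δ →
            ENNReal.ofReal (1 / 2 + η) ≤ (‖∫ Z in C2, (starRingEnd ℂ) (Θ Z) * Φ Z‖₊ : ENNReal) ^ 2) :
    TorusHalfSwapOverlap := by
  intro v hv
  by_cases hb : ∃ M : NNReal, ∀ r, v r ≤ M
  · exact stub_cruxOfChord v hv (stub_chordOfPath h0 v hv hb)
  · exact stub_cruxOfChord v hv (h1b v hv hb)

end Summit.AtomisticToContinuum.BoseEinsteinCondensation.Cruxes.TorusHalfSwapOverlap.Birth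

end
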